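import Literature.Barriers.PneNP.NOFLogNBarrier
import Mathlib.Algebra.BigOperators.Fin
import Mathlib.Algebra.BigOperators.Group.Finset.Piecewise
import Mathlib.Algebra.BigOperators.Group.Finset.Sigma
import Mathlib.Algebra.BigOperators.Ring.Finset
import Mathlib.Algebra.Order.BigOperators.Group.Finset
import Mathlib.Algebra.Order.Group.Unbundled.Int
import Mathlib.Data.Fin.Tuple.Basic
import Mathlib.Data.Fin.Tuple.NatAntidiagonal
import Mathlib.Data.Fintype.BigOperators
import Mathlib.Data.Fintype.EquivFin
import Mathlib.Data.Nat.Log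
import Mathlib.Logic.Equiv.Basic
import Mathlib.Tactic.Linarith
import Mathlib.Tactic.Positivity
import Mathlib.Tactic.Ring
import HarnessLib

/-!
# Barrier `NOFBlockWidthBarrier` (Hamoudi 2018, Thm. 12): the deterministic simultaneous protocol, proved

D-0014 discharge of the named fact `Literature.Barriers.PneNP.NOFBlockWidthBarrier`
(`NOFLogNBarrier.lean`): "Let `n ≥ 2`, `d ≥ 2` and suppose `k ≥ 4^{2^{⌈log d⌉}} log n`. For any
composed function `f ∘ g⃗ ∈ SYM ∘ SYM⃗_{ℤ_d}` there exists a deterministic simultaneous NOF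
protocol that computes it with cost `4^{2^{⌈log d⌉+2}} log^{2·2^{⌈log d⌉}}(n)`" — in the tree's
Boolean block form: for every block width `t ≥ 1` a constant `C = C(t)` such that for
`k ≥ C log₂ n` players every `f ∘ g⃗` with `f` symmetric and every `g_j` row-symmetric has a
valid simultaneous protocol (`SimultaneousProtocol`, cost = total number of bits) of cost
`≤ C (log₂ n)^{2^{t+1}}`.

**Part 1 — the counting lemma (Hamoudi, Thm. 9 and Lemmas 13–14).** [Hamoudi2018]
Y. Hamoudi, *Simultaneous multiparty communication protocols for composed functions*, MFCS
2018 (LIPIcs 117) 14:1–14:15 (held; numbering of the LIPIcs version throughout — the arXiv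
version 1710.01969 numbers Prop. 8, Thm. 9, Thm. 12, Lemmas 13–14 as Prop. 3, Thm. 4, Thm. 7,
Lemmas 8–9), Thm. 9 and App. A (Lemma 13, "Lemma for the Equation Solving part"; Lemma 14):
let `M` be an `ℓ × n` matrix over an alphabet of `d + 1` letters and let `y_T` be the number
of columns of each TYPE `T` (the vector of multiplicities of the letters, a vector of sum
`ℓ`). Player `i`, who sees every row but row `i`, announces for every type `T'` of sum `ℓ - 1`
the number `aⁱ_{T'}` of columns whose other `ℓ - 1` entries have type `T'`. Then (Thm. 9,
eq. (3)) `Σᵢ aⁱ_{T'} = Σ_σ (T'(σ) + 1) · y_{T' + σ}` — a column of type `T` is counted, at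
`T' = T - σ`, once for each of its `T(σ)` rows carrying the letter `σ` — and (Lemma 13) this
linear system in the unknowns `y` has at most one integral solution with `y ≥ 0`, `Σ y ≤ n` as
soon as `ℓ ≥ 4^d log n`; Lemma 14 is the homogeneous form "no nonzero integral solution `z`
with `Σ |z| ≤ 2n`", proved by induction on the alphabet size (base case `d = 1`:
[BabaiGalKimmelLokam2003]; step: the lowest nonzero level `κ` of `z` solves the system for
`d - 1` letters, so `κ` is small by induction, and `(ℓ - i) Z_i ≤ (i + d) Z_{i+1}` for the
level maxima `Z_i` forces geometric growth past `2n`).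

*What is proved in Part 1.* `typeDown` (the right-hand side operator of eq. (3) on integer
functions of count vectors `Fin D → ℕ`), `typeDown_cons` (peeling letter `0`),
`typeDown_eq_zero_unique` (Lemma 14 in SUP-norm form with crude constants: for every alphabet
size `D` there is `A` such that a solution `z` of the homogeneous system at sum `ℓ` with
`|z_T| ≤ N` vanishes once `ℓ ≥ A (log₂ N + 1)`; constants `A₀ = 1`, `A_{D+1} = 3 A_D + 2 D + 6`
instead of Hamoudi's `4^d`, since the barrier fact quantifies its constant existentially),
`typeCount_unique` (Lemma 13: two bounded nonnegative count functions with the same image under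
the operator agree); the column-type bookkeeping `colType` / `colTypeErase` of a word
`Fin ℓ → Fin D` with `sum_colType`, `sum_colTypeErase`, `colTypeErase_eq_iff`, the player-sum
identity `sum_card_filter_colTypeErase` (eq. (3), for any selected sub-family of columns),
`exists_perm_of_colType_eq` (words of equal type differ by a permutation of positions — how
row-symmetric inner functions factor through types) and the index bound
`card_antidiagonalTuple_succ_le` (`#{T : Fin (E+1) → ℕ | Σ T = m} ≤ (m + 1)^E`).

**Part 2 — the protocol (Hamoudi 2018, §3) and how it is rendered.**

* *Equation solving (Thm. 9, Lemma 13).* Over an alphabet of `D` letters (here the `D = 2^t`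
  possible sub-rows `{0,1}^t` of a block), player `i < ℓ` announces, for every count vector
  `T'` of sum `ℓ - 1`, the number of (selected) blocks whose rows `i' < ℓ`, `i' ≠ i`, have
  type `T'`; the sum over `i` of these numbers is `typeDown` of the histogram of block types
  (`sum_card_filter_colTypeErase`), and the histogram is the unique bounded solution
  (`typeCount_unique`, Lemma 13, once `ℓ ≥ A_D (log₂ n + 1)`) — Part 1 above.
* *Reduction to the first `ℓ = Θ_t(log n)` players (proof of Thm. 12).* Only players `i < ℓ`
  speak; the rows `≥ ℓ` of block `j` are seen by all of them and turn `g_j` into an induced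
  function `g̃_j` of the first `ℓ` sub-rows, still row-symmetric, hence a function of the TYPE
  of the head of the block (`glue_eq_of_colType_eq`, from `exists_perm_of_colType_eq` and
  `Equiv.Perm.extendDomain`).
* *Different inner functions (proof of Thm. 12).* Hamoudi expands each `g̃_j` over the basis
  of monomial `k`-symmetric polynomials `m_a` over `𝔽_p` (Prop. 8) and runs Thm. 9 once per
  basis element on the matrix in which block `j` is repeated `c_a(g̃_j)` times. Since the
  barrier fact states its constant existentially, we use instead the INDICATOR basis of types
  (same index set, the count vectors of sum `ℓ`; no field arithmetic): round `T` runs Thm. 9 on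
  the sub-family of blocks `j` with `g̃_j(T) = 1` (`selFn`), the referee learns the number of
  such blocks whose head has type `T`, and summing over `T` gives `#{j | g_j(B_j) = 1}`, which
  determines `f` (`bw_determined`). Cost: `ℓ` speakers × `#types_ℓ · #types_{ℓ-1}` numbers of
  `log₂ n + 1` bits `≤ (ℓ+1)^{2(D-1)+1} (log₂ n + 1) = O_t((log n)^{2D}) = C(t) (log₂ n)^{2^{t+1}}`
  (`card_antidiagonalTuple_succ_le`); constants are not optimised (`ℓ = A_D (⌊log₂ n⌋ + 1)`,
  `C(t) = (8 A_D)^{2D}` with the crude `A_D` of `typeDown_eq_zero_unique`, versus the printed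
  `4^{2^t}` and `4^{2^t+2}`).
* *The referee* is obtained abstractly (`hasSimultaneousProtocol_of_determined`): speakers
  send tuples of numbers `< 2^B` in binary, and if the messages DETERMINE `F(X)` then
  `F ∘ (any preimage)` is a correct referee; so the content of the protocol is the theorem
  "equal messages ⇒ equal value" (`bw_determined`), i.e. Lemma 13 plus the bookkeeping above.

## Sources

* [Hamoudi2018] §1.3 Defs. 1–2, §1.4, §3.1 Thm. 9 with eqs. (3)–(4) and its proof, Cor. 10,
  §3.2 Thm. 12 and its proof, §4, App. A Lemmas 13–14 with eqs. (5)–(8) and their proofs —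
  held, both the LIPIcs version (`lit read 10.4230/lipics.mfcs.2018.14`, whose numbering is
  used) and arXiv:1710.01969 (`lit read arxiv:1710.01969`; there Thm. 4, Cor. 5, Thm. 7,
  Lemmas 8–9).
* [Jukna2012] Exercise 5.7 (the referee model) — through `NOFLogNBarrier.lean`.
-/

noncomputable section

namespace Literature.Barriers.PneNP

open Finset

/-! ### The operator of Hamoudi's equation (5) and its kernel -/

/-- **The "one row hidden" counting operator** (right-hand side of Hamoudi's eq. (3)): for an
integer function `z` of count vectors over `D` letters and a count vector `T'` (of sum `ℓ - 1`),
`typeDown z T' = Σ_σ (T'(σ) + 1) · z (T' + e_σ)`. [cite: Hamoudi2018, Thm. 9, eq. (3)] -/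
def typeDown {D : ℕ} (z : (Fin D → ℕ) → ℤ) (T' : Fin D → ℕ) : ℤ :=
  ∑ s : Fin D, ((T' s : ℤ) + 1) * z (Function.update T' s (T' s + 1))

/-- The same operator on natural-number valued count functions. [cite: Hamoudi2018, Thm. 9, eq. (3)] -/
def typeDownNat {D : ℕ} (y : (Fin D → ℕ) → ℕ) (T' : Fin D → ℕ) : ℕ :=
  ∑ s : Fin D, (T' s + 1) * y (Function.update T' s (T' s + 1))

/-- `typeDown` of a natural-valued function is the cast of `typeDownNat`. [folklore] -/
theorem typeDown_natCast {D : ℕ} (y : (Fin D → ℕ) → ℕ) (T' : Fin D → ℕ) :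
    typeDown (fun T => (y T : ℤ)) T' = (typeDownNat y T' : ℤ) := by
  simp only [typeDown, typeDownNat, Nat.cast_sum, Nat.cast_mul, Nat.cast_add, Nat.cast_one]

/-- `typeDown` is additive: the difference of two functions. [folklore] -/
theorem typeDown_sub {D : ℕ} (y y' : (Fin D → ℕ) → ℤ) (T' : Fin D → ℕ) :
    typeDown (fun T => y T - y' T) T' = typeDown y T' - typeDown y' T' := by
  simp only [typeDown, mul_sub, Finset.sum_sub_distrib]

/-- Peeling the letter `0`: on a count vector `(c, e)` the operator splits into the term that
raises the multiplicity of letter `0` and the operator for the remaining `D` letters.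
[cite: Hamoudi2018, App. A, proof of Lemma 14 (a)] -/
theorem typeDown_cons {D : ℕ} (z : (Fin (D + 1) → ℕ) → ℤ) (c : ℕ) (e : Fin D → ℕ) :
    typeDown z (Fin.cons c e) = ((c : ℤ) + 1) * z (Fin.cons (c + 1) e) +
      typeDown (fun e' : Fin D → ℕ => z (Fin.cons c e')) e := by
  unfold typeDown
  rw [Fin.sum_univ_succ]
  simp only [Fin.cons_zero, Fin.cons_succ, Fin.update_cons_zero, ← Fin.cons_update]

/-- Raising one multiplicity raises the sum by one. [folklore] -/
theorem sum_update_succ {D : ℕ} (e : Fin D → ℕ) (s : Fin D) :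
    ∑ s', Function.update e s (e s + 1) s' = ∑ s', e s' + 1 := by
  rw [Finset.sum_update_of_mem (Finset.mem_univ s), Finset.sdiff_singleton_eq_erase, add_comm,
    ← add_assoc, Finset.sum_erase_add _ _ (Finset.mem_univ s)]

/-- **Hamoudi, Lemma 14 (homogeneous uniqueness), sup-norm form with crude constants.** For every
alphabet size `D` there is a constant `A ≥ 1` such that: if `z` is an integer function of count
vectors, `typeDown z T' = 0` for every `T'` of sum `ℓ - 1`, and `|z T| ≤ N` for every `T` of sum
`ℓ`, then `z T = 0` for every `T` of sum `ℓ`, provided `ℓ ≥ A (log₂ N + 1)`. (Printed: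
`ℓ > 4^d log n - d` with the `ℓ¹` bound `Σ|z| ≤ 2n`; the proof is Hamoudi's induction on the
number of letters — the lowest nonzero level solves the system with one letter fewer, then the
level maxima at least double while `3 i + 2 D ≤ ℓ`.) [cite: Hamoudi2018, App. A, Lemma 14] -/
theorem typeDown_eq_zero_unique : ∀ D : ℕ, ∃ A : ℕ, 1 ≤ A ∧
    ∀ (k N : ℕ) (z : (Fin D → ℕ) → ℤ), A * (Nat.log 2 N + 1) ≤ k →
      (∀ T' : Fin D → ℕ, ∑ s, T' s + 1 = k → typeDown z T' = 0) →
      (∀ T : Fin D → ℕ, ∑ s, T s = k → |z T| ≤ N) →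
      ∀ T : Fin D → ℕ, ∑ s, T s = k → z T = 0 := by
  intro D
  induction D with
  | zero =>
    refine ⟨1, le_rfl, fun k N z hk _ _ T hT => ?_⟩
    simp only [Finset.univ_eq_empty, Finset.sum_empty] at hT
    omega
  | succ D ih =>
    obtain ⟨A, hA1, hA⟩ := ih
    refine ⟨3 * A + 2 * D + 6, by omega, fun k N z hk hdown hsup T₀ hT₀ => ?_⟩
    classical
    by_contra hz₀
    -- the sum of a count vector splits off the multiplicity of letter `0`
    have tail_sum : ∀ T : Fin (D + 1) → ℕ, ∑ s, T s = T 0 + ∑ s, Fin.tail T s := by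
      intro T
      conv_lhs => rw [← Fin.cons_self_tail T]
      exact Fin.sum_cons (T 0) (Fin.tail T)
    -- levels: `P i` = some nonzero `z T` with `T` of sum `k` and `k - T 0 = i`
    let P : ℕ → Prop := fun i => ∃ T : Fin (D + 1) → ℕ, ∑ s, T s = k ∧ T 0 + i = k ∧ z T ≠ 0
    have hP : ∃ i, P i := by
      refine ⟨∑ s, Fin.tail T₀ s, T₀, hT₀, ?_, hz₀⟩
      have := tail_sum T₀
      omega
    obtain ⟨T₁, hT₁, hT₁0, hz₁⟩ : P (Nat.find hP) := Nat.find_spec hP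
    have hmin : ∀ i < Nat.find hP, ∀ T : Fin (D + 1) → ℕ, ∑ s, T s = k → T 0 + i = k → z T = 0 := by
      intro i hi T hT hTi
      by_contra h
      exact Nat.find_min hP hi ⟨T, hT, hTi, h⟩
    set κ := Nat.find hP with hκdef
    -- (a) the lowest nonzero level is small, by induction (one letter fewer)
    have hκ : κ < A * (Nat.log 2 N + 1) := by
      by_contra hle
      push Not at hle
      set c := T₁ 0 with hc
      have hz' := hA κ N (fun e => z (Fin.cons c e)) hle ?_ ?_ (Fin.tail T₁) ?_
      · rw [hc, Fin.cons_self_tail] at hz'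
        exact hz₁ hz'
      · intro e' he'
        have h1 := hdown (Fin.cons c e') (by rw [Fin.sum_cons]; omega)
        rw [typeDown_cons] at h1
        have h2 : z (Fin.cons (c + 1) e') = 0 := by
          refine hmin (κ - 1) (by omega) _ (by rw [Fin.sum_cons]; omega) ?_
          simp only [Fin.cons_zero]
          omega
        rw [h2, mul_zero, zero_add] at h1
        exact h1
      · intro e he
        exact hsup _ (by rw [Fin.sum_cons]; omega)
      · have := tail_sum T₁
        omega
    -- (b) doubling growth of the level maxima while `3 i + 2 D ≤ k`
    have hgrow : ∀ d : ℕ, 3 * (κ + d) + 2 * D ≤ k →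
        ∃ T : Fin (D + 1) → ℕ, ∑ s, T s = k ∧ T 0 + (κ + d) = k ∧ (2 : ℤ) ^ d ≤ |z T| := by
      intro d
      induction d with
      | zero =>
        intro _
        exact ⟨T₁, hT₁, by simpa using hT₁0, by simpa using Int.one_le_abs hz₁⟩
      | succ d ihd =>
        intro hd
        obtain ⟨T, hT, hTi, hzT⟩ := ihd (by omega)
        obtain ⟨c', hc'⟩ : ∃ c', T 0 = c' + 1 := ⟨T 0 - 1, by omega⟩
        have htail : ∑ s, Fin.tail T s = κ + d := by
          have := tail_sum T
          omega
        have h1 := hdown (Fin.cons c' (Fin.tail T)) (by rw [Fin.sum_cons]; omega)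
        rw [typeDown_cons, ← hc', Fin.cons_self_tail] at h1
        by_contra hall
        push Not at hall
        -- every successor at level `κ + d + 1` is below `2 |z T|`
        have hbound : ∀ s : Fin D,
            |z (Fin.cons c' (Function.update (Fin.tail T) s (Fin.tail T s + 1)))| ≤
              2 * |z T| - 1 := by
          intro s
          have hlt := hall (Fin.cons c' (Function.update (Fin.tail T) s (Fin.tail T s + 1)))
            (by rw [Fin.sum_cons, sum_update_succ]; omega)
            (by simp only [Fin.cons_zero]; omega)
          have h2 : (2 : ℤ) ^ (d + 1) = 2 * 2 ^ d := by ring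
          have h3 := Int.lt_iff_add_one_le.mp hlt
          linarith
        have habs : ((c' : ℤ) + 1) * |z T| ≤ ((κ + d + D : ℕ) : ℤ) * (2 * |z T| - 1) := by
          have e1 : ((c' : ℤ) + 1) * |z T| =
              |typeDown (fun e' => z (Fin.cons c' e')) (Fin.tail T)| := by
            have hpos : (0 : ℤ) ≤ (c' : ℤ) + 1 := by positivity
            rw [show typeDown (fun e' => z (Fin.cons c' e')) (Fin.tail T) =
                -(((c' : ℤ) + 1) * z T) by linarith, abs_neg, abs_mul, abs_of_nonneg hpos]
          rw [e1]
          unfold typeDown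
          calc |∑ s, ((Fin.tail T s : ℤ) + 1) *
                  z (Fin.cons c' (Function.update (Fin.tail T) s (Fin.tail T s + 1)))|
              ≤ ∑ s, |((Fin.tail T s : ℤ) + 1) *
                  z (Fin.cons c' (Function.update (Fin.tail T) s (Fin.tail T s + 1)))| :=
                Finset.abs_sum_le_sum_abs _ _
            _ = ∑ s, ((Fin.tail T s : ℤ) + 1) *
                  |z (Fin.cons c' (Function.update (Fin.tail T) s (Fin.tail T s + 1)))| := by
                refine Finset.sum_congr rfl fun s _ => ?_
                rw [abs_mul, abs_of_nonneg (by positivity)]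
            _ ≤ ∑ s, ((Fin.tail T s : ℤ) + 1) * (2 * |z T| - 1) :=
                Finset.sum_le_sum fun s _ => mul_le_mul_of_nonneg_left (hbound s) (by positivity)
            _ = (∑ s, ((Fin.tail T s : ℤ) + 1)) * (2 * |z T| - 1) := (Finset.sum_mul _ _ _).symm
            _ = ((κ + d + D : ℕ) : ℤ) * (2 * |z T| - 1) := by
                congr 1
                rw [Finset.sum_add_distrib, ← Nat.cast_sum, htail]
                simp
        have hzT1 : (1 : ℤ) ≤ |z T| := le_trans (one_le_pow₀ (by norm_num)) hzT
        have hc'big : 2 * ((κ + d + D : ℕ) : ℤ) + 3 ≤ (c' : ℤ) + 1 := by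
          push_cast
          have : 2 * (κ + d + D) + 3 ≤ c' + 1 := by omega
          exact_mod_cast this
        nlinarith [mul_le_mul_of_nonneg_right hc'big (abs_nonneg (z T)), abs_nonneg (z T)]
    -- (c) contradiction at level `m = A (log₂ N + 1) + log₂ N + 1`
    set L := Nat.log 2 N with hL
    have hkM : 3 * (A * (L + 1)) + 3 * (L + 1) + 2 * D ≤ k := by
      nlinarith [hk, Nat.zero_le D, Nat.zero_le L]
    set M := A * (L + 1) with hM
    have hk' : 3 * (κ + (M + L + 1 - κ)) + 2 * D ≤ k := by omega
    obtain ⟨T, hT, -, hzT⟩ := hgrow (M + L + 1 - κ) hk'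
    have h2 : (2 : ℤ) ^ (L + 1) ≤ (2 : ℤ) ^ (M + L + 1 - κ) :=
      pow_le_pow_right₀ (by norm_num) (by omega)
    have h3 : |z T| ≤ (N : ℤ) := hsup T hT
    have h4 : (N : ℤ) < (2 : ℤ) ^ (L + 1) := by
      exact_mod_cast Nat.lt_pow_succ_log_self one_lt_two N
    linarith

/-- **Hamoudi, Lemma 13 (uniqueness of the column-type histogram).** For every alphabet size `D`
there is `A ≥ 1` such that two count functions `y, y'` bounded by `N` on the vectors of sum `ℓ`
and with the same image under the operator of eq. (3) on the vectors of sum `ℓ - 1` agree on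
the vectors of sum `ℓ`, provided `ℓ ≥ A (log₂ N + 1)` (printed: `ℓ ≥ 4^d log n`, `y, y' ≥ 0`,
`Σ y, Σ y' ≤ n`). [cite: Hamoudi2018, App. A, Lemma 13] -/
theorem typeCount_unique (D : ℕ) : ∃ A : ℕ, 1 ≤ A ∧
    ∀ (ℓ N : ℕ) (y y' : (Fin D → ℕ) → ℕ), A * (Nat.log 2 N + 1) ≤ ℓ →
      (∀ T' : Fin D → ℕ, ∑ s, T' s + 1 = ℓ → typeDownNat y T' = typeDownNat y' T') →
      (∀ T : Fin D → ℕ, ∑ s, T s = ℓ → y T ≤ N) →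
      (∀ T : Fin D → ℕ, ∑ s, T s = ℓ → y' T ≤ N) →
      ∀ T : Fin D → ℕ, ∑ s, T s = ℓ → y T = y' T := by
  obtain ⟨A, hA1, hA⟩ := typeDown_eq_zero_unique D
  refine ⟨A, hA1, fun ℓ N y y' hℓ hdown hy hy' T hT => ?_⟩
  have h := hA ℓ N (fun T => (y T : ℤ) - y' T) hℓ ?_ ?_ T hT
  · simpa [sub_eq_zero] using h
  · intro T' hT'
    rw [typeDown_sub, typeDown_natCast, typeDown_natCast, hdown T' hT', sub_self]
  · intro T hT
    have h1 := hy T hT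
    have h2 := hy' T hT
    rw [abs_sub_le_iff]
    have h1' := Nat.cast_le (α := ℤ) |>.2 h1
    have h2' := Nat.cast_le (α := ℤ) |>.2 h2
    constructor <;> linarith [Nat.cast_nonneg (α := ℤ) (y T), Nat.cast_nonneg (α := ℤ) (y' T)]

/-! ### Column types of words and the player-sum identity -/

/-- **The type of a word** (a column of the matrix read over the speaking rows): the count
vector `a ↦ #{i | u i = a}`. [cite: Hamoudi2018, §1.4 ("Counting up to symmetry") and Thm. 9] -/
def colType {ℓ D : ℕ} (u : Fin ℓ → Fin D) : Fin D → ℕ :=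
  fun a => (univ.filter fun i => u i = a).card

/-- **The type of a word with position `i` hidden** (what player `i` sees of the column):
`a ↦ #{i' ≠ i | u i' = a}`. [cite: Hamoudi2018, Thm. 9 (the numbers `aⁱ`)] -/
def colTypeErase {ℓ D : ℕ} (i : Fin ℓ) (u : Fin ℓ → Fin D) : Fin D → ℕ :=
  fun a => ((univ.erase i).filter fun i' => u i' = a).card

/-- The multiplicities of a word of length `ℓ` sum to `ℓ`. [folklore] -/
theorem sum_colType {ℓ D : ℕ} (u : Fin ℓ → Fin D) : ∑ a, colType u a = ℓ := by
  unfold colType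
  rw [← Finset.card_eq_sum_card_fiberwise (f := u) (s := univ) (t := univ) fun _ _ => mem_univ _]
  simp

/-- With one position hidden the multiplicities sum to `ℓ - 1`. [folklore] -/
theorem sum_colTypeErase {ℓ D : ℕ} (i : Fin ℓ) (u : Fin ℓ → Fin D) :
    ∑ a, colTypeErase i u a + 1 = ℓ := by
  unfold colTypeErase
  rw [← Finset.card_eq_sum_card_fiberwise (f := u) (s := univ.erase i) (t := univ)
    fun _ _ => mem_univ _, Finset.card_erase_of_mem (mem_univ i)]
  simp only [card_univ, Fintype.card_fin]
  have := i.2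
  omega

/-- Hiding position `i` lowers the multiplicity of the letter `u i` by one and keeps the others.
[folklore] -/
theorem colType_eq_colTypeErase_add {ℓ D : ℕ} (i : Fin ℓ) (u : Fin ℓ → Fin D) (a : Fin D) :
    colType u a = colTypeErase i u a + if u i = a then 1 else 0 := by
  unfold colType colTypeErase
  rw [Finset.filter_erase]
  by_cases h : u i = a
  · have hmem : i ∈ univ.filter fun i' => u i' = a := by simp [h]
    rw [if_pos h, Finset.card_erase_of_mem hmem]
    have := Finset.card_pos.2 ⟨i, hmem⟩
    omega
  · have hmem : i ∉ univ.filter fun i' => u i' = a := by simp [h]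
    rw [if_neg h, Finset.erase_eq_of_notMem hmem, add_zero]

/-- The hidden-position type changes only with the visible positions. [folklore] -/
theorem colTypeErase_congr {ℓ D : ℕ} (i : Fin ℓ) {u u' : Fin ℓ → Fin D}
    (h : ∀ i', i' ≠ i → u i' = u' i') : colTypeErase i u = colTypeErase i u' := by
  funext a
  unfold colTypeErase
  congr 1
  refine Finset.filter_congr fun i' hi' => ?_
  rw [h i' (Finset.mem_erase.1 hi').1]

/-- What player `i` sees is `T'` iff the full type is `T'` with the multiplicity of her own
(hidden) letter raised by one. [cite: Hamoudi2018, proof of Thm. 9] -/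
theorem colTypeErase_eq_iff {ℓ D : ℕ} (i : Fin ℓ) (u : Fin ℓ → Fin D) (T' : Fin D → ℕ) :
    colTypeErase i u = T' ↔ colType u = Function.update T' (u i) (T' (u i) + 1) := by
  constructor
  · intro h
    funext a
    rw [colType_eq_colTypeErase_add i, h]
    by_cases ha : a = u i
    · subst ha
      simp
    · rw [Function.update_of_ne ha, if_neg (Ne.symm ha), add_zero]
  · intro h
    funext a
    have h1 := congrFun h a
    rw [colType_eq_colTypeErase_add i] at h1
    by_cases ha : a = u i
    · subst ha
      simp only [if_true, Function.update_self] at h1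
      omega
    · rw [Function.update_of_ne ha, if_neg (Ne.symm ha), add_zero] at h1
      exact h1

/-- For one word: the number of positions whose hiding shows `T'` is
`Σ_a (T'(a) + 1) · [colType u = T' + e_a]`. [cite: Hamoudi2018, proof of Thm. 9] -/
theorem card_filter_colTypeErase_eq {ℓ D : ℕ} (u : Fin ℓ → Fin D) (T' : Fin D → ℕ) :
    (univ.filter fun i => colTypeErase i u = T').card =
      ∑ a, if colType u = Function.update T' a (T' a + 1) then T' a + 1 else 0 := by
  classical
  have h1 : (univ.filter fun i => colTypeErase i u = T') =
      univ.filter fun i => colType u = Function.update T' (u i) (T' (u i) + 1) :=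
    Finset.filter_congr fun i _ => colTypeErase_eq_iff i u T'
  rw [h1, Finset.card_eq_sum_card_fiberwise (f := u) (t := univ) fun _ _ => mem_univ _]
  refine Finset.sum_congr rfl fun a _ => ?_
  rw [Finset.filter_filter]
  by_cases hT : colType u = Function.update T' a (T' a + 1)
  · rw [if_pos hT]
    have h2 : (univ.filter fun i => colType u = Function.update T' (u i) (T' (u i) + 1) ∧ u i = a)
        = univ.filter fun i => u i = a := by
      refine Finset.filter_congr fun i _ => ⟨fun h => h.2, fun h => ⟨?_, h⟩⟩
      rw [h]
      exact hT
    rw [h2]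
    have h3 := congrFun hT a
    simp only [colType, Function.update_self] at h3
    exact h3
  · rw [if_neg hT, Finset.card_eq_zero, Finset.filter_eq_empty_iff]
    rintro i - ⟨h, rfl⟩
    exact hT h

/-- Double counting: summing fibre cardinalities either way. [folklore] -/
theorem sum_card_filter_comm {α β : Type*} (s : Finset α) (t : Finset β) (P : α → β → Prop)
    [∀ a b, Decidable (P a b)] :
    ∑ a ∈ s, (t.filter (P a)).card = ∑ b ∈ t, (s.filter fun a => P a b).card := by
  simp_rw [Finset.card_filter]
  exact Finset.sum_comm

/-- **Hamoudi's equation (5) (the player-sum identity).** For a family of words `w j`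
(`j ∈ J`, the columns) and any selected sub-family `sel`, summing over the hidden position `i`
the number of selected columns that show `T'` to player `i` gives `typeDownNat y T'`, where
`y T` is the number of selected columns of type `T`: "the total contribution for `b_{e}` is
`(k - (e₁ + ⋯ + e_d)) y_e + Σ_{s'} (e_{s'} + 1) y_{e + δ_{s'}}`". [cite: Hamoudi2018, Thm. 9, eq. (3)] -/
theorem sum_card_filter_colTypeErase {J : Type*} [Fintype J] {ℓ D : ℕ} (w : J → Fin ℓ → Fin D)
    (sel : J → Prop) [DecidablePred sel] (T' : Fin D → ℕ) :
    ∑ i : Fin ℓ, (univ.filter fun j => sel j ∧ colTypeErase i (w j) = T').card =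
      typeDownNat (fun T => (univ.filter fun j => sel j ∧ colType (w j) = T).card) T' := by
  classical
  rw [sum_card_filter_comm]
  have hR : typeDownNat (fun T => (univ.filter fun j => sel j ∧ colType (w j) = T).card) T' =
      ∑ j : J, if sel j then
        ∑ a, (if colType (w j) = Function.update T' a (T' a + 1) then T' a + 1 else 0) else 0 := by
    unfold typeDownNat
    simp_rw [Finset.card_filter, Finset.mul_sum]
    rw [Finset.sum_comm (β := ℕ) (α := J) (γ := Fin D)]
    refine Finset.sum_congr rfl fun j _ => ?_
    by_cases hj : sel j <;> simp [hj]
  rw [hR]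
  refine Finset.sum_congr rfl fun j _ => ?_
  by_cases hj : sel j
  · simp only [hj, true_and, if_true]
    exact card_filter_colTypeErase_eq (w j) T'
  · simp [hj]

/-- **Words of the same type differ by a permutation of positions** (glue bijections between
the letter fibres) — the reason a row-symmetric inner function is a function of the column
type. [folklore] -/
theorem exists_perm_of_colType_eq {ℓ D : ℕ} {u u' : Fin ℓ → Fin D} (h : colType u = colType u') :
    ∃ σ : Equiv.Perm (Fin ℓ), ∀ i, u' (σ i) = u i := by
  classical
  have hcard : ∀ a : Fin D, Fintype.card {i // u i = a} = Fintype.card {i // u' i = a} := by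
    intro a
    rw [Fintype.card_subtype, Fintype.card_subtype]
    exact congrFun h a
  exact ⟨Equiv.ofFiberEquiv fun a => Fintype.equivOfCardEq (hcard a),
    fun i => Equiv.ofFiberEquiv_map (fun a => Fintype.equivOfCardEq (hcard a)) i⟩

/-! ### The size of the index sets -/

/-- **The number of count vectors of a given sum**: `#{T : Fin (E+1) → ℕ | Σ T = m} ≤ (m+1)^E`
(a vector of sum `m` is determined by its last `E` coordinates, each at most `m`; the exact
value is `C(m + E, E)`). [folklore] -/
theorem card_antidiagonalTuple_succ_le (E m : ℕ) :
    (Finset.Nat.antidiagonalTuple (E + 1) m).card ≤ (m + 1) ^ E := by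
  classical
  let f : (Fin (E + 1) → ℕ) → (Fin E → Fin (m + 1)) := fun T s => ⟨min (T s.succ) m, by omega⟩
  calc (Finset.Nat.antidiagonalTuple (E + 1) m).card
      ≤ (univ : Finset (Fin E → Fin (m + 1))).card := by
        refine Finset.card_le_card_of_injOn f (fun _ _ => Finset.mem_coe.2 (mem_univ _)) ?_
        intro T hT T' hT' hTT'
        rw [Finset.mem_coe, Finset.Nat.mem_antidiagonalTuple] at hT hT'
        have htail : ∀ s : Fin E, T s.succ = T' s.succ := by
          intro s
          have h1 : T s.succ ≤ m :=
            hT ▸ Finset.single_le_sum (fun _ _ => Nat.zero_le _) (mem_univ _)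
          have h2 : T' s.succ ≤ m :=
            hT' ▸ Finset.single_le_sum (fun _ _ => Nat.zero_le _) (mem_univ _)
          have h3 := congrFun hTT' s
          simp only [f, Fin.mk.injEq] at h3
          omega
        have h0 : T 0 = T' 0 := by
          rw [Fin.sum_univ_succ] at hT hT'
          have : ∑ s : Fin E, T s.succ = ∑ s : Fin E, T' s.succ :=
            Finset.sum_congr rfl fun s _ => htail s
          omega
        funext s
        exact Fin.cases h0 htail s
    _ = (m + 1) ^ E := by simp

/-! ### Simultaneous protocols from number-valued messages that determine the value -/

/-- Numbers below `2^B` with the same `B` low bits are equal. [folklore] -/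
theorem eq_of_testBit_eq_of_lt {B x y : ℕ} (hx : x < 2 ^ B) (hy : y < 2 ^ B)
    (h : ∀ b : Fin B, x.testBit b = y.testBit b) : x = y := by
  rw [← decodeBits_testBit B x hx, ← decodeBits_testBit B y hy]
  congr 1
  funext b
  exact h b

/-- At most `ℓ` players have index `< ℓ`. [folklore] -/
theorem card_filter_val_lt_le (k ℓ : ℕ) :
    (univ.filter fun i : Fin k => (i : ℕ) < ℓ).card ≤ ℓ := by
  calc (univ.filter fun i : Fin k => (i : ℕ) < ℓ).card ≤ (Finset.range ℓ).card := by
        refine Finset.card_le_card_of_injOn (fun i => (i : ℕ)) (fun i hi => ?_)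
          (fun i _ j _ h => Fin.ext h)
        have hi' := (Finset.mem_filter.1 (Finset.mem_coe.1 hi)).2
        exact Finset.mem_coe.2 (Finset.mem_range.2 hi')
    _ = ℓ := Finset.card_range ℓ

/-- **Uniform-speaker simultaneous protocols, abstractly.** If the first `ℓ ≤ k` players each
compute a tuple of numbers `< 2^B` (indexed by a finite type `ι`) that does not depend on
their own row, and these tuples DETERMINE `F(X)`, then `F` has a valid simultaneous protocol of
cost `ℓ · |ι| · B`: the speakers write their numbers in binary, the others write nothing, and
the referee outputs `F` of any input consistent with the messages.
[cite: Jukna2012, Exercise 5.7 (PDF p. 174)] -/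
theorem hasSimultaneousProtocol_of_determined {k N ℓ B : ℕ} {ι : Type} [Fintype ι]
    (hℓ : ℓ ≤ k) (F : NOFInput k N → Bool) (msg : Fin ℓ → NOFInput k N → ι → ℕ)
    (hind : ∀ i : Fin ℓ, IndepOfRow (Fin.castLE hℓ i) (msg i))
    (hbound : ∀ i X a, msg i X a < 2 ^ B)
    (hdet : ∀ X X', (∀ i, msg i X = msg i X') → F X = F X') :
    HasSimultaneousProtocol F (ℓ * (Fintype.card ι * B)) := by
  classical
  set L := Fintype.card ι * B with hL
  let eι : ι ≃ Fin (Fintype.card ι) := Fintype.equivFin ι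
  let bits : Fin ℓ → NOFInput k N → Fin L → Bool := fun i X p =>
    (msg i X (eι.symm (finProdFinEquiv.symm p).1)).testBit (finProdFinEquiv.symm p).2
  let len : Fin k → ℕ := fun i => if (i : ℕ) < ℓ then L else 0
  have hlen : ∀ i : Fin k, (i : ℕ) < ℓ → len i = L := fun i h => if_pos h
  let m : (i : Fin k) → NOFInput k N → Fin (len i) → Bool := fun i X p =>
    if h : (i : ℕ) < ℓ then bits ⟨i, h⟩ X (p.cast (hlen i h)) else false
  let S : SimultaneousProtocol k N :=
    { len := len
      msg := m
      referee := fun M => if h : ∃ X, (fun i => m i X) = M then F (Classical.choose h) else false }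
  refine ⟨S, ?_, ?_, ?_⟩
  · -- validity: speaker `i`'s bits are bits of numbers that do not depend on row `i`
    intro i X r
    funext p
    show m i (Function.update X i r) p = m i X p
    simp only [m]
    split_ifs with h
    · have hc : Fin.castLE hℓ ⟨i, h⟩ = i := Fin.ext rfl
      have h1 := hind ⟨i, h⟩ X r
      rw [hc] at h1
      simp only [bits, h1]
    · rfl
  · -- cost: `ℓ` speakers of `L` bits each
    show (∑ i, len i) ≤ ℓ * (Fintype.card ι * B)
    simp only [len]
    rw [Finset.sum_ite, Finset.sum_const_zero, add_zero, Finset.sum_const, smul_eq_mul]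
    exact Nat.mul_le_mul_right _ (card_filter_val_lt_le k ℓ)
  · -- correctness: any input consistent with the messages has the same value
    intro X
    show (if h : ∃ X', (fun i => m i X') = fun i => m i X then F (Classical.choose h) else false)
      = F X
    have hex : ∃ X', (fun i => m i X') = fun i => m i X := ⟨X, rfl⟩
    rw [dif_pos hex]
    apply hdet
    intro i
    have hi : ((Fin.castLE hℓ i : Fin k) : ℕ) < ℓ := i.2
    have hmk : (⟨((Fin.castLE hℓ i : Fin k) : ℕ), hi⟩ : Fin ℓ) = i := Fin.ext rfl
    have hspec := congrFun (Classical.choose_spec hex) (Fin.castLE hℓ i)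
    have hbits : ∀ q : Fin L, bits i (Classical.choose hex) q = bits i X q := by
      intro q
      have h1 := congrFun hspec (q.cast (hlen _ hi).symm)
      simp only [m, hi, dif_pos, hmk] at h1
      simpa using h1
    funext a
    refine eq_of_testBit_eq_of_lt (hbound i _ a) (hbound i X a) fun b => ?_
    have h1 := hbits (finProdFinEquiv (eι a, b))
    simp only [bits, Equiv.symm_apply_apply] at h1
    exact h1

/-! ### Blocks, heads and the induced inner functions -/

variable {k n t : ℕ}

/-- The sub-row of player `i` in block `j` (the `t` bits `X i (j t + s)`).
[cite: Hamoudi2018, §1.3 (Def. 1)] -/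
def rowOf (X : NOFInput k (n * t)) (i : Fin k) (j : Fin n) : Fin t → Bool :=
  fun s => X i (finProdFinEquiv (j, s))

/-- Block `j` of the input as a `k`-tuple of sub-rows. [cite: Hamoudi2018, §1.3 (Def. 1)] -/
def blockOf (X : NOFInput k (n * t)) (j : Fin n) : Fin k → Fin t → Bool := fun i => rowOf X i j

/-- `composeBlockNOF` evaluates `g_j` on block `j` (definitional). [cite: Hamoudi2018, §1.3 (Def. 1)] -/
theorem composeBlockNOF_eq_blockOf (f : (Fin n → Bool) → Bool)
    (g : Fin n → (Fin k → Fin t → Bool) → Bool) (X : NOFInput k (n * t)) :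
    composeBlockNOF f g X = f fun j => g j (blockOf X j) := rfl

/-- Changing row `i` does not change the other sub-rows. [folklore] -/
theorem rowOf_update_of_ne {X : NOFInput k (n * t)} {i i' : Fin k} (h : i' ≠ i)
    (r : Fin (n * t) → Bool) (j : Fin n) : rowOf (Function.update X i r) i' j = rowOf X i' j := by
  funext s
  simp [rowOf, Function.update_of_ne h]

/-- The `2^t` sub-rows `{0,1}^t` as letters `Fin (2^t)` (Hamoudi's `ℤ_d`, `d = 2^t`).
[cite: Hamoudi2018, §1.3 (Def. 2)] -/
def encRow (t : ℕ) : (Fin t → Bool) ≃ Fin (2 ^ t) := Fintype.equivFinOfCardEq (by simp)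

/-- Replacing the first `ℓ` sub-rows (the head) of a block by the word `u`.
[cite: Hamoudi2018, proof of Thm. 12 (`u · v_j`)] -/
def glue {ℓ : ℕ} (u : Fin ℓ → Fin t → Bool) (B : Fin k → Fin t → Bool) : Fin k → Fin t → Bool :=
  fun i => if h : (i : ℕ) < ℓ then u ⟨i, h⟩ else B i

/-- The head of block `j`: the sub-rows of the speaking players `i < ℓ`, as a word over
`Fin (2^t)`. [cite: Hamoudi2018, proof of Thm. 12 (the sub-block `B̃_j`)] -/
def headWord {ℓ : ℕ} (hℓ : ℓ ≤ k) (X : NOFInput k (n * t)) (j : Fin n) : Fin ℓ → Fin (2 ^ t) :=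
  fun i => encRow t (rowOf X (Fin.castLE hℓ i) j)

/-- Gluing a block's own head back gives the block. [folklore] -/
theorem glue_headWord {ℓ : ℕ} (hℓ : ℓ ≤ k) (X : NOFInput k (n * t)) (j : Fin n) :
    glue (fun i => (encRow t).symm (headWord hℓ X j i)) (blockOf X j) = blockOf X j := by
  funext i
  unfold glue
  split_ifs with h
  · have hc : Fin.castLE hℓ ⟨i, h⟩ = i := Fin.ext rfl
    simp only [headWord, Equiv.symm_apply_apply, hc, blockOf]
  · rfl

/-- Changing a head row does not change a glued block. [folklore] -/
theorem glue_blockOf_update {ℓ : ℕ} (u : Fin ℓ → Fin t → Bool) (X : NOFInput k (n * t))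
    (j : Fin n) {i : Fin k} (hi : (i : ℕ) < ℓ) (r : Fin (n * t) → Bool) :
    glue u (blockOf (Function.update X i r) j) = glue u (blockOf X j) := by
  funext i'
  unfold glue
  split_ifs with h
  · rfl
  · have hne : i' ≠ i := fun he => h (he ▸ hi)
    exact rowOf_update_of_ne hne r j

/-- Changing the row of speaker `i` does not change the other letters of a head. [folklore] -/
theorem headWord_update_of_ne {ℓ : ℕ} (hℓ : ℓ ≤ k) (X : NOFInput k (n * t)) (j : Fin n)
    {i i' : Fin ℓ} (h : i' ≠ i) (r : Fin (n * t) → Bool) :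
    headWord hℓ (Function.update X (Fin.castLE hℓ i) r) j i' = headWord hℓ X j i' := by
  unfold headWord
  rw [rowOf_update_of_ne ((Fin.castLE_injective hℓ).ne h)]

/-- **Row-symmetric inner functions factor through the type of the head.** If two head words
have the same type then gluing either onto the same tail gives the same value of a
row-symmetric `g_j` (the words differ by a permutation of the head rows, which extends to a
permutation of all rows fixing the tail). [cite: Hamoudi2018, proof of Thm. 12 ("`g̃_j` is still a symmetric function")] -/
theorem glue_eq_of_colType_eq {ℓ : ℕ} (hℓ : ℓ ≤ k) {gj : (Fin k → Fin t → Bool) → Bool}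
    (hg : IsRowSymmetric gj) {u u' : Fin ℓ → Fin (2 ^ t)} (h : colType u = colType u')
    (B : Fin k → Fin t → Bool) :
    gj (glue (fun i => (encRow t).symm (u i)) B) = gj (glue (fun i => (encRow t).symm (u' i)) B) := by
  obtain ⟨σ, hσ⟩ := exists_perm_of_colType_eq h
  let emb : Fin ℓ ≃ {i : Fin k // (i : ℕ) < ℓ} :=
    { toFun := fun i => ⟨Fin.castLE hℓ i, i.2⟩
      invFun := fun i => ⟨i.1, i.2⟩
      left_inv := fun i => Fin.ext rfl
      right_inv := fun i => Subtype.ext (Fin.ext rfl) }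
  have key : glue (fun i => (encRow t).symm (u i)) B =
      fun i => glue (fun i => (encRow t).symm (u' i)) B (σ.extendDomain emb i) := by
    funext i
    by_cases hi : (i : ℕ) < ℓ
    · rw [Equiv.Perm.extendDomain_apply_subtype σ emb hi]
      have h2 : (((emb (σ (emb.symm ⟨i, hi⟩)) : Fin k) : ℕ) < ℓ) := (σ (emb.symm ⟨i, hi⟩)).2
      have h3 : (⟨((emb (σ (emb.symm ⟨i, hi⟩)) : Fin k) : ℕ), h2⟩ : Fin ℓ) = σ ⟨i, hi⟩ :=
        Fin.ext rfl
      simp only [glue, dif_pos hi, dif_pos h2, h3, hσ]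
    · rw [Equiv.Perm.extendDomain_apply_not_subtype σ emb hi]
      simp only [glue, dif_neg hi]
  rw [key]
  exact hg (σ.extendDomain emb) _

/-- **The selection of round `T`** (the indicator-basis coefficient of the induced inner
function): `selFn ℓ g T j X = g̃_j(T)`, i.e. `g_j` evaluated on any head of type `T` glued onto
the true tail of block `j` (`false` if no word has type `T`). It depends on `X` only through
the rows `≥ ℓ`. [cite: Hamoudi2018, proof of Thm. 12 (the coefficients `c_a(g̃_j)`, here for the indicator basis)] -/
def selFn (ℓ : ℕ) (g : Fin n → (Fin k → Fin t → Bool) → Bool) (T : Fin (2 ^ t) → ℕ)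
    (j : Fin n) (X : NOFInput k (n * t)) : Bool :=
  if h : ∃ u : Fin ℓ → Fin (2 ^ t), colType u = T then
    g j (glue (fun i => (encRow t).symm (Classical.choose h i)) (blockOf X j))
  else false

/-- At the true type of the head, the selection is the true inner value `g_j(B_j)`.
[cite: Hamoudi2018, proof of Thm. 12] -/
theorem selFn_colType {ℓ : ℕ} (hℓ : ℓ ≤ k) {g : Fin n → (Fin k → Fin t → Bool) → Bool}
    {j : Fin n} (hg : IsRowSymmetric (g j)) (X : NOFInput k (n * t)) :
    selFn ℓ g (colType (headWord hℓ X j)) j X = g j (blockOf X j) := by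
  have h : ∃ u : Fin ℓ → Fin (2 ^ t), colType u = colType (headWord hℓ X j) := ⟨_, rfl⟩
  unfold selFn
  rw [dif_pos h, glue_eq_of_colType_eq hℓ hg (Classical.choose_spec h) (blockOf X j),
    glue_headWord]

/-- The selection does not depend on the head rows. [folklore] -/
theorem selFn_update {ℓ : ℕ} (g : Fin n → (Fin k → Fin t → Bool) → Bool)
    (T : Fin (2 ^ t) → ℕ) (j : Fin n) (X : NOFInput k (n * t)) {i : Fin k} (hi : (i : ℕ) < ℓ)
    (r : Fin (n * t) → Bool) : selFn ℓ g T j (Function.update X i r) = selFn ℓ g T j X := by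
  unfold selFn
  split_ifs with h
  · rw [glue_blockOf_update _ X j hi r]
  · rfl

/-! ### The messages and what they determine -/

/-- The index set of count vectors of a given sum, as a finite type.
[cite: Hamoudi2018, Thm. 9 (the indices `e₁ + ⋯ + e_d ≤ k`)] -/
abbrev TypeIdx (D m : ℕ) : Type := {T : Fin D → ℕ // T ∈ Finset.Nat.antidiagonalTuple D m}

/-- **The messages.** Speaker `i < ℓ` sends, for every round `T` (a type of sum `ℓ`) and every
type `T'` of sum `ℓ - 1`, the number of blocks selected in round `T` whose head, with her own
sub-row hidden, has type `T'` — Hamoudi's `aⁱ_{e₁,…,e_d}` for the matrix of round `T`.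
[cite: Hamoudi2018, Thm. 9 and proof of Thm. 12] -/
def bwMsg (ℓ : ℕ) (hℓ : ℓ ≤ k) (g : Fin n → (Fin k → Fin t → Bool) → Bool) (i : Fin ℓ)
    (X : NOFInput k (n * t)) (p : TypeIdx (2 ^ t) ℓ × TypeIdx (2 ^ t) (ℓ - 1)) : ℕ :=
  (univ.filter fun j : Fin n =>
    selFn ℓ g p.1.1 j X = true ∧ colTypeErase i (headWord hℓ X j) = p.2.1).card

/-- The messages of speaker `i` do not depend on row `i` (validity in the NOF model).
[cite: Hamoudi2018, Thm. 9 ("from her point of view")] -/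
theorem bwMsg_indepOfRow (ℓ : ℕ) (hℓ : ℓ ≤ k) (g : Fin n → (Fin k → Fin t → Bool) → Bool)
    (i : Fin ℓ) : IndepOfRow (Fin.castLE hℓ i) (bwMsg ℓ hℓ g i) := by
  intro X r
  funext p
  unfold bwMsg
  congr 1
  refine Finset.filter_congr fun j _ => ?_
  rw [selFn_update g p.1.1 j X (i := Fin.castLE hℓ i) i.2 r,
    colTypeErase_congr i fun i' hi' => headWord_update_of_ne hℓ X j hi' r]

/-- Each message is a number `≤ n < 2^{⌊log₂ n⌋ + 1}`. [folklore] -/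
theorem bwMsg_lt (ℓ : ℕ) (hℓ : ℓ ≤ k) (g : Fin n → (Fin k → Fin t → Bool) → Bool) (i : Fin ℓ)
    (X : NOFInput k (n * t)) (p : TypeIdx (2 ^ t) ℓ × TypeIdx (2 ^ t) (ℓ - 1)) :
    bwMsg ℓ hℓ g i X p < 2 ^ (Nat.log 2 n + 1) := by
  calc bwMsg ℓ hℓ g i X p ≤ n := (Finset.card_filter_le _ _).trans (by simp)
    _ < 2 ^ (Nat.log 2 n + 1) := Nat.lt_pow_succ_log_self one_lt_two n

/-- **Equal messages ⇒ equal value (the referee can decode).** With `ℓ ≥ A (log₂ n + 1)`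
speakers, `A` the constant of `typeCount_unique` for `2^t` letters: the sums over `i` of the
messages of round `T` are `typeDown` of the round-`T` histogram (eq. (3)), so by Lemma 13 the
histograms of `X` and `X'` agree; summing their diagonal entries over `T` gives the number of
blocks with `g_j(B_j) = 1`, which determines the symmetric `f`. [cite: Hamoudi2018, proof of Thm. 12] -/
theorem bw_determined {ℓ A : ℕ}
    (hA : ∀ (ℓ N : ℕ) (y y' : (Fin (2 ^ t) → ℕ) → ℕ), A * (Nat.log 2 N + 1) ≤ ℓ →
      (∀ T' : Fin (2 ^ t) → ℕ, ∑ s, T' s + 1 = ℓ → typeDownNat y T' = typeDownNat y' T') →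
      (∀ T : Fin (2 ^ t) → ℕ, ∑ s, T s = ℓ → y T ≤ N) →
      (∀ T : Fin (2 ^ t) → ℕ, ∑ s, T s = ℓ → y' T ≤ N) →
      ∀ T : Fin (2 ^ t) → ℕ, ∑ s, T s = ℓ → y T = y' T)
    (hℓA : A * (Nat.log 2 n + 1) ≤ ℓ) (hℓ : ℓ ≤ k)
    {f : (Fin n → Bool) → Bool} (hf : IsSymmetricFn f)
    {g : Fin n → (Fin k → Fin t → Bool) → Bool} (hg : ∀ j, IsRowSymmetric (g j))
    (X X' : NOFInput k (n * t)) (hmsg : ∀ i, bwMsg ℓ hℓ g i X = bwMsg ℓ hℓ g i X') :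
    composeBlockNOF f g X = composeBlockNOF f g X' := by
  classical
  -- the round-`T` histograms of head types
  let y : NOFInput k (n * t) → (Fin (2 ^ t) → ℕ) → (Fin (2 ^ t) → ℕ) → ℕ := fun Y T U =>
    (univ.filter fun j : Fin n => selFn ℓ g T j Y = true ∧ colType (headWord hℓ Y j) = U).card
  have hy_le : ∀ Y T U, y Y T U ≤ n := fun Y T U => (Finset.card_filter_le _ _).trans (by simp)
  -- step 1 (eq. (3)): equal messages give equal images under the operator
  have hdown : ∀ (T : TypeIdx (2 ^ t) ℓ) (T' : Fin (2 ^ t) → ℕ), ∑ s, T' s + 1 = ℓ →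
      typeDownNat (y X T.1) T' = typeDownNat (y X' T.1) T' := by
    intro T T' hT'
    have hmem : T' ∈ Finset.Nat.antidiagonalTuple (2 ^ t) (ℓ - 1) := by
      rw [Finset.Nat.mem_antidiagonalTuple]
      omega
    have e := fun Y : NOFInput k (n * t) =>
      sum_card_filter_colTypeErase (headWord hℓ Y) (fun j => selFn ℓ g T.1 j Y = true) T'
    rw [← e X, ← e X']
    refine Finset.sum_congr rfl fun i _ => ?_
    exact congrFun (hmsg i) (T, ⟨T', hmem⟩)
  -- step 2 (Lemma 13): the histograms agree, in particular on the diagonal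
  have hyeq : ∀ T : TypeIdx (2 ^ t) ℓ, y X T.1 T.1 = y X' T.1 T.1 := by
    intro T
    have hT : ∑ s, T.1 s = ℓ := Finset.Nat.mem_antidiagonalTuple.1 T.2
    exact hA ℓ n (y X T.1) (y X' T.1) hℓA (hdown T) (fun U _ => hy_le X T.1 U)
      (fun U _ => hy_le X' T.1 U) T.1 hT
  -- step 3: the number of true inner values is the diagonal sum over the rounds
  have hcount : ∀ Y : NOFInput k (n * t),
      (univ.filter fun j : Fin n => g j (blockOf Y j) = true).card =
        ∑ T : TypeIdx (2 ^ t) ℓ, y Y T.1 T.1 := by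
    intro Y
    let τ : Fin n → TypeIdx (2 ^ t) ℓ := fun j =>
      ⟨colType (headWord hℓ Y j), Finset.Nat.mem_antidiagonalTuple.2 (sum_colType _)⟩
    rw [Finset.card_eq_sum_card_fiberwise (f := τ) (t := univ) fun _ _ => mem_univ _]
    refine Finset.sum_congr rfl fun T _ => ?_
    simp only [y, Finset.filter_filter]
    congr 1
    refine Finset.filter_congr fun j _ => ?_
    constructor
    · rintro ⟨hgj, hτ⟩
      have hU : colType (headWord hℓ Y j) = T.1 := congrArg Subtype.val hτ
      refine ⟨?_, hU⟩
      rw [← hU, selFn_colType hℓ (hg j)]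
      exact hgj
    · rintro ⟨hsel, hU⟩
      refine ⟨?_, Subtype.ext hU⟩
      rw [← hU, selFn_colType hℓ (hg j)] at hsel
      exact hsel
  -- step 4: `f` is symmetric
  rw [composeBlockNOF_eq_blockOf, composeBlockNOF_eq_blockOf]
  refine hf _ _ ?_
  rw [hcount X, hcount X']
  exact Finset.sum_congr rfl fun T _ => hyeq T

/-! ### Hamoudi's Theorem 12 -/

/-- **Hamoudi 2018, Thm. 12, proved**: the barrier fact `NOFBlockWidthBarrier` holds — for
every block width `t ≥ 1` there is `C` such that for `k ≥ C log₂ n` players every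
`f ∘ g⃗ ∈ SYM ∘ SYM⃗_{ℤ_{2^t}}` on `n ≥ 2` blocks has a valid deterministic simultaneous NOF
protocol of cost `≤ C (log₂ n)^{2^{t+1}}`. The protocol is Hamoudi's (first
`ℓ = A (⌊log₂ n⌋ + 1)` players speak; one equation-solving round of Thm. 9 per element of a
basis of the row-symmetric functions of the head, here the indicator basis of head types;
decoding by Lemma 13), with unoptimised constants `C = (8A)^{2·2^t}`.
[cite: Hamoudi2018, Thm. 12 and its proof (§3.2)] -/
theorem NOFBlockWidthBarrier_holds : NOFBlockWidthBarrier := by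
  intro t ht
  obtain ⟨A, hA1, hA⟩ := typeCount_unique (2 ^ t)
  obtain ⟨E, hE⟩ : ∃ E : ℕ, 2 ^ t = E + 1 :=
    ⟨2 ^ t - 1, by have := Nat.one_le_two_pow (n := t); omega⟩
  have hCpos : 0 < (8 * A) ^ (2 * E + 2) := pow_pos (by omega) _
  refine ⟨((8 * A) ^ (2 * E + 2) : ℕ), by exact_mod_cast hCpos, ?_⟩
  intro k n hn hk f hf g hg
  set L := Nat.log 2 n with hL
  set ℓ := A * (L + 1) with hℓdef
  -- real-number bookkeeping: `1 ≤ log₂ n`, `L ≤ log₂ n`, `ℓ + 1 ≤ 3 A log₂ n ≤ C log₂ n ≤ k`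
  have hlogb1 : 1 ≤ Real.logb 2 n := by
    calc (1 : ℝ) = Real.logb 2 2 := (Real.logb_self_eq_one one_lt_two).symm
      _ ≤ Real.logb 2 n := Real.logb_le_logb_of_le one_lt_two two_pos (by exact_mod_cast hn)
  have hLle : (L : ℝ) ≤ Real.logb 2 n := by
    have hfl : ⌊Real.logb 2 (n : ℝ)⌋₊ = Nat.log 2 n := by
      simpa using Real.natFloor_logb_natCast 2 n
    rw [hL, ← hfl]
    exact Nat.floor_le (by linarith)
  have hA1' : (1 : ℝ) ≤ A := by exact_mod_cast hA1
  have hℓle : (ℓ : ℝ) + 1 ≤ 3 * A * Real.logb 2 n := by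
    rw [hℓdef]
    push_cast
    have h1 : (A : ℝ) * L ≤ A * Real.logb 2 n := mul_le_mul_of_nonneg_left hLle (by positivity)
    have h2 : (A : ℝ) ≤ A * Real.logb 2 n := le_mul_of_one_le_right (by positivity) hlogb1
    have h3 : (1 : ℝ) ≤ A * Real.logb 2 n := one_le_mul_of_one_le_of_one_le hA1' hlogb1
    linarith
  have hCge : (3 * A : ℝ) ≤ ((8 * A) ^ (2 * E + 2) : ℕ) := by
    have : 3 * A ≤ (8 * A) ^ (2 * E + 2) := by
      calc 3 * A ≤ 8 * A := by omega
        _ = (8 * A) ^ 1 := (pow_one _).symm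
        _ ≤ (8 * A) ^ (2 * E + 2) := Nat.pow_le_pow_right (by omega) (by omega)
    exact_mod_cast this
  have hℓk : ℓ ≤ k := by
    have h1 : (ℓ : ℝ) ≤ k := by
      have := mul_le_mul_of_nonneg_right hCge (by linarith : (0 : ℝ) ≤ Real.logb 2 n)
      linarith [hk, hℓle]
    exact_mod_cast h1
  have hℓA : A * (Nat.log 2 n + 1) ≤ ℓ := le_rfl
  -- the protocol
  obtain ⟨S, hv, hc, he⟩ := hasSimultaneousProtocol_of_determined hℓk (composeBlockNOF f g)
    (bwMsg ℓ hℓk g) (fun i => bwMsg_indepOfRow ℓ hℓk g i) (fun i X p => bwMsg_lt ℓ hℓk g i X p)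
    (fun X X' h => bw_determined hA hℓA hℓk hf hg X X' h)
  refine ⟨S, hv, he, ?_⟩
  -- cost in naturals: `ℓ · (#types_ℓ · #types_{ℓ-1}) · (L + 1) ≤ (ℓ+1)^{2E+1} (L+1)`
  have hcard : Fintype.card (TypeIdx (2 ^ t) ℓ × TypeIdx (2 ^ t) (ℓ - 1)) ≤ (ℓ + 1) ^ (2 * E) := by
    rw [Fintype.card_prod, Fintype.card_coe, Fintype.card_coe, hE]
    calc (Finset.Nat.antidiagonalTuple (E + 1) ℓ).card *
          (Finset.Nat.antidiagonalTuple (E + 1) (ℓ - 1)).card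
        ≤ (ℓ + 1) ^ E * (ℓ - 1 + 1) ^ E :=
          Nat.mul_le_mul (card_antidiagonalTuple_succ_le E ℓ)
            (card_antidiagonalTuple_succ_le E (ℓ - 1))
      _ ≤ (ℓ + 1) ^ E * (ℓ + 1) ^ E :=
          Nat.mul_le_mul_left _ (Nat.pow_le_pow_left (by omega) E)
      _ = (ℓ + 1) ^ (2 * E) := by rw [← pow_add, two_mul]
  have hcostN : S.cost ≤ (ℓ + 1) ^ (2 * E + 1) * (L + 1) := by
    calc S.cost ≤ ℓ * (Fintype.card (TypeIdx (2 ^ t) ℓ × TypeIdx (2 ^ t) (ℓ - 1)) * (L + 1)) := hc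
      _ ≤ (ℓ + 1) * ((ℓ + 1) ^ (2 * E) * (L + 1)) :=
          Nat.mul_le_mul (Nat.le_succ ℓ) (Nat.mul_le_mul_right _ hcard)
      _ = (ℓ + 1) ^ (2 * E + 1) * (L + 1) := by ring
  -- to the reals
  have h2E : 2 ^ (t + 1) = 2 * E + 2 := by rw [pow_succ, hE]; ring
  rw [h2E]
  have hlog0 : (0 : ℝ) ≤ Real.logb 2 n := by linarith
  have hL1 : ((L + 1 : ℕ) : ℝ) ≤ 2 * Real.logb 2 n := by push_cast; linarith
  have hℓ1 : ((ℓ + 1 : ℕ) : ℝ) ≤ 3 * A * Real.logb 2 n := by push_cast; exact hℓle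
  have hconst : (2 * (3 * A) ^ (2 * E + 1) : ℝ) ≤ ((8 * A) ^ (2 * E + 2) : ℕ) := by
    have : 2 * (3 * A) ^ (2 * E + 1) ≤ (8 * A) ^ (2 * E + 2) := by
      calc 2 * (3 * A) ^ (2 * E + 1) ≤ (8 * A) * (8 * A) ^ (2 * E + 1) :=
            Nat.mul_le_mul (by omega) (Nat.pow_le_pow_left (by omega) _)
        _ = (8 * A) ^ (2 * E + 2) := by ring
    exact_mod_cast this
  calc (S.cost : ℝ) ≤ ((ℓ + 1 : ℕ) : ℝ) ^ (2 * E + 1) * ((L + 1 : ℕ) : ℝ) := by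
        exact_mod_cast hcostN
    _ ≤ (3 * A * Real.logb 2 n) ^ (2 * E + 1) * (2 * Real.logb 2 n) :=
        mul_le_mul (pow_le_pow_left₀ (by positivity) hℓ1 _) hL1 (by positivity) (by positivity)
    _ = 2 * (3 * A) ^ (2 * E + 1) * Real.logb 2 n ^ (2 * E + 2) := by ring
    _ ≤ ((8 * A) ^ (2 * E + 2) : ℕ) * Real.logb 2 n ^ (2 * E + 2) :=
        mul_le_mul_of_nonneg_right hconst (by positivity)

end Literature.Barriers.PneNP

end
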